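import Summits.RiemannHypothesis.RiemannHypothesis.Theses.DensityLadder
import HarnessLib

/-!
# `DensityLadder.Assembly` (item stmt-RiemannHypothesis-19835) — glue closer

The unfolded assembly `∀ A σ₀, A < 30/13 → ZDE(A, 1/2) → σ₀ < 25/32 → ZDE(2, σ₀) → LadderResidual → RH`
follows by feeding `LadderResidual : BeatThirtyThirteenths → DensityBelowBourgain → RH` the two
existential packages `⟨A, _, _⟩` and `⟨σ₀, _, _⟩`.
Cell rh-split (typer-3 g3 glue sweep, RULING #374).  Pure propositional glue; no analysis.
Nothing here bears on the truth of RH.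
-/

set_option linter.dupNamespace false  -- the mandated namespace repeats `RiemannHypothesis`

namespace Summit.RiemannHypothesis.RiemannHypothesis.Theorems.DensityLadder

/-- **`Assembly` (item stmt-RiemannHypothesis-19835) holds**: package the two density hypotheses
and apply `LadderResidual`. [folklore] -/
theorem assembly_proof : Summit.RiemannHypothesis.RiemannHypothesis.Theses.DensityLadder.Assembly :=
  fun A σ₀ hA hZ hσ hZ' hR => hR ⟨A, hA, hZ⟩ ⟨σ₀, hσ, hZ'⟩

end Summit.RiemannHypothesis.RiemannHypothesis.Theorems.DensityLadder
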